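import Summits.CriticalPhenomena.SAWScalingLimit.Theorems.BoundaryClosureR.Negative.GateRoot

/-!
# Negative knowledge on crux `BoundaryClosureR` (stmt-CriticalPhenomena-14004), cycle 2, part 2/2:
`FlatGateBudget` is false as typed — the root may sit INSIDE the gate ball

`not_flatGateBudget` refutes, verbatim, the typed positive-mass input `FlatGateBudget` of the gate line
(`Cruxes/BoundaryClosureR/Ideator1Sketch.lean`, cards runge-gated-green-pairing / sector-bootstrap):
"for every admissible pinned family, `δ · Σ_{e ∈ ∂Λ_δ, δ·mid e ∈ B(pt 1, ρ)} Z_δ(e) ≤ C · Z_δ(b_δ)`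
eventually".  The frame of the repaired target lets the two pin balls overlap (then both marked points
lie on one floor), so the ROOT may lie in the gate ball: instance `halfDiscDomain (1/5)` (root
`pt 0 = 1/5`, normaliser `pt 1 = 0`), `ρ = 1/4`, the cycle-1 family `Lam δ false`, root `hang (kOf δ)`,
normaliser `bEdge`.  The gate sum then contains `Z_δ(a_δ) = 1`, so the budget forces
`δ ≤ C · Z_δ(a_δ → b_δ)`; along `δ_k = 1/(5k)` the right-hand sides are arrival masses of ONE strip
at pairwise distinct α-edges (`sum_norm_obs_le_stripA`), bounded in total by `1/cos(3π/8)` (DCS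
Lemma 2), while `Σ_k 1/(5k)` diverges.  REPAIR (what the gate line means): sum over a gate
`B(pt 1, ρ') ∩ ∂Λ_δ` with `ρ' < dist(pt 0, pt 1)`, or require the two pin balls to be disjoint.
Everything proved. [folklore]
-/

noncomputable section

open Set Filter Topology Complex Finset
open Literature.Probability.RandomPlanarGeometry
open Literature.Probability.LatticeModels Literature.Probability.RandomPlanarGeometry.SAW
open Literature.Probability.RandomPlanarGeometry.SAW.HV

namespace Summit.CriticalPhenomena.SAWScalingLimit.Theorems.BoundaryClosureR.Negative

open BoundaryClosure.Negative

/-! ### The root cell `kOf δ = ⌊1/(5δ)⌋₊` -/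

/-- The root cell: the rescaled root `δ (kOf δ + 1/2)` tends to `1/5`. [folklore] -/
def kOf (δ : ℝ) : ℕ := ⌊1 / (5 * δ)⌋₊

/-- Bounds on the root cell for `0 < δ ≤ 1/16`. [folklore] -/
theorem kOf_spec {δ : ℝ} (hδ : 0 < δ) (hδ' : δ ≤ 1 / 16) :
    3 ≤ kOf δ ∧ δ * kOf δ ≤ 1 / 5 ∧ 1 / 5 - δ < δ * kOf δ := by
  have hx : (0 : ℝ) ≤ 1 / (5 * δ) := by positivity
  have h1 : ((kOf δ : ℕ) : ℝ) ≤ 1 / (5 * δ) := Nat.floor_le hx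
  have h2 : 1 / (5 * δ) < (kOf δ : ℝ) + 1 := Nat.lt_floor_add_one _
  have e : δ * (1 / (5 * δ)) = 1 / 5 := by field_simp
  refine ⟨?_, ?_, ?_⟩
  · refine (Nat.le_floor_iff hx).2 ?_
    rw [le_div_iff₀ (by positivity)]
    push_cast
    nlinarith
  · calc δ * kOf δ ≤ δ * (1 / (5 * δ)) := by gcongr
      _ = 1 / 5 := e
  · have := mul_lt_mul_of_pos_left h2 hδ
    rw [e, mul_add, mul_one] at this
    linarith

/-- The root cell lies left of the junction cell: `2·kOf δ ≤ 2X + 1`. [folklore] -/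
theorem kOf_le_Xc {δ : ℝ} (hδ : 0 < δ) : 2 * ((kOf δ : ℕ) : ℤ) ≤ 2 * Xc δ + 1 := by
  have hx : (0 : ℝ) ≤ 1 / (5 * δ) := by positivity
  have h1 : ((kOf δ : ℕ) : ℝ) ≤ 1 / (5 * δ) := Nat.floor_le hx
  have hX := (Xc_bounds δ).1
  have h3 : 1 / (5 * δ) ≤ 1 / (2 * δ) := by gcongr; norm_num
  have h4 : ((kOf δ : ℕ) : ℝ) ≤ Xc δ := by linarith
  have h5 : ((kOf δ : ℕ) : ℤ) ≤ Xc δ := by exact_mod_cast h4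
  omega

/-- At `δ = 1/(5k)` the root cell is `k`. [folklore] -/
theorem kOf_at {k : ℕ} (hk : k ≠ 0) : kOf (1 / (5 * k)) = k := by
  unfold kOf
  rw [show (1 : ℝ) / (5 * (1 / (5 * (k : ℝ)))) = k by field_simp]
  exact Nat.floor_natCast k

/-! ### The root `hang (kOf δ)` in the half-disc family `Lam δ false` -/

section Frame

variable {δ : ℝ} (hδ : 0 < δ) (hδ' : δ ≤ 1 / 16)
include hδ hδ'

/-- The outer endpoint of `hang k` is never a vertex (row `-1`). [folklore] -/
theorem outer_not_mem (k : ℕ) : fj (2 * k + 1) (-1) ∉ Lam δ false := fun h =>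
  compl_of_neg hδ hδ' false (j := 2 * (k : ℤ) + 1) (by norm_num) (Finset.mem_coe.2 h)

/-- **The root edge is a boundary mid-edge** of `Lam δ false`. [folklore] -/
theorem hang_mem_boundary : hang (kOf δ) ∈ hexDomainBoundary (Lam δ false) := by
  have hk := kOf_le_Xc hδ
  refine ⟨(SimpleGraph.mem_edgeSet hexGraph).2 (adj_hang _), fj (2 * (kOf δ) + 1) (-1),
    fj (2 * (kOf δ)) 0, Sym2.eq_swap, ?_, outer_not_mem hδ hδ' _⟩
  exact fj_row_zero_mem hδ hδ' false (i := 2 * ((kOf δ : ℕ) : ℤ)) (by positivity)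
    (by simp only [rootCell, Bool.false_eq_true, ↓reduceIte]; omega)

/-- The rescaled root lies in the gate ball `B(0, 1/4)`. [folklore] -/
theorem smul_midpoint_hang_mem_ball :
    (δ : ℂ) * hexMidpoint (hang (kOf δ)) ∈ Metric.ball (0 : ℂ) (1 / 4) := by
  obtain ⟨-, h1, -⟩ := kOf_spec hδ hδ'
  rw [hexMidpoint_hang, Metric.mem_ball, dist_zero_right, ← Complex.ofReal_mul, Complex.norm_real,
    Real.norm_of_nonneg (by positivity)]
  nlinarith

end Frame

/-- In a connected domain, any two DISTINCT boundary mid-edges `{w, u}`, `{w', u'}` (`w, w' ∈ Λ`,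
`u, u' ∉ Λ`) are joined by a self-avoiding walk: a simple path `w ⇝ w'` of the induced graph uses
only edges with both ends in `Λ`. (Cycle-1 Disproof.lean §3, re-proved here.) [folklore] -/
theorem nonempty_midEdgeSAW_of_preconnected {Λ : Finset HexVertex}
    (hconn : (hexGraph.induce ((Λ : Finset HexVertex) : Set HexVertex)).Preconnected)
    {u w u' w' : HexVertex} (huw : hexGraph.Adj w u) (hu : u ∉ Λ) (hw : w ∈ Λ)
    (hu' : u' ∉ Λ) (hw' : w' ∈ Λ) (hab : s(w, u) ≠ s(w', u')) :
    Nonempty (HexMidEdgeSAW Λ s(w, u) s(w', u')) := by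
  classical
  obtain ⟨p⟩ := hconn ⟨w, hw⟩ ⟨w', hw'⟩
  set q := p.toPath with hq
  set L : List HexVertex := q.1.support.map Subtype.val with hL
  have hLΛ : ∀ v ∈ L, v ∈ Λ := by
    intro v hv
    rw [hL, List.mem_map] at hv
    obtain ⟨x, -, rfl⟩ := hv
    exact x.2
  have hLnd : L.Nodup := (q.2.support_nodup).map Subtype.val_injective
  have hLch : L.IsChain hexGraph.Adj := by
    rw [hL, List.isChain_map]
    exact (SimpleGraph.Walk.isChain_adj_support _).imp fun a b h => by simpa using h
  have hLcons : L = w :: (q.1.support.tail.map Subtype.val) := by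
    rw [hL, ← SimpleGraph.Walk.cons_tail_support]; rfl
  have hLne : L ≠ [] := by rw [hLcons]; exact List.cons_ne_nil _ _
  have hhead : L.head? = some w := by rw [hLcons]; rfl
  have hlast : L.getLast? = some w' := by
    rw [hL, List.getLast?_map, List.getLast?_eq_some_getLast (SimpleGraph.Walk.support_ne_nil _),
      SimpleGraph.Walk.getLast_support]
    rfl
  have hmem : ∀ e ∈ List.zipWith (fun a b => s(a, b)) L L.tail, ∀ c ∈ e, c ∈ Λ := fun e he c hc =>
    hLΛ c (forall_mem_of_mem_edges _ e he c hc)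
  have haL : s(w, u) ∉ List.zipWith (fun a b => s(a, b)) L L.tail := fun h =>
    hu (hmem _ h u (Sym2.mem_mk_right _ _))
  have hbL : s(w', u') ∉ List.zipWith (fun a b => s(a, b)) L L.tail := fun h =>
    hu' (hmem _ h u' (Sym2.mem_mk_right _ _))
  refine ⟨{ verts := L
            subset := hLΛ
            nodup := hLnd
            isChain := hLch
            head_mem := fun v hv => ?_
            getLast_mem := fun v hv => ?_
            eq_of_nil := fun h => (hLne h).elim
            edges_nodup := fun _ => ?_
            fst_mem := ⟨(SimpleGraph.mem_edgeSet hexGraph).2 huw, w, Sym2.mem_mk_left _ _, hw⟩ }⟩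
  · rw [hhead, Option.some_inj] at hv; subst hv; exact Sym2.mem_mk_left _ _
  · rw [hlast, Option.some_inj] at hv; subst hv; exact Sym2.mem_mk_left _ _
  · refine List.nodup_append.2 ⟨List.nodup_cons.2 ⟨haL, edges_nodup hLnd⟩, List.nodup_singleton _, ?_⟩
    intro e he f hf
    rw [List.mem_singleton] at hf
    subst hf
    rcases List.mem_cons.1 he with rfl | he
    · exact hab
    · rintro rfl; exact hbL he

/-- **There is a self-avoiding walk from the root to the normaliser.** [folklore] -/
theorem nonempty_saw_hang {δ : ℝ} (hδ : 0 < δ) (hδ' : δ ≤ 1 / 16) :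
    Nonempty (HexMidEdgeSAW (Lam δ false) (hang (kOf δ)) bEdge) := by
  have hk : kOf δ ≠ 0 := by have := (kOf_spec hδ hδ').1; omega
  have hw : fj (2 * (kOf δ)) 0 ∈ Lam δ false :=
    fj_row_zero_mem hδ hδ' false (i := 2 * ((kOf δ : ℕ) : ℤ)) (by positivity)
      (by have := kOf_le_Xc hδ; simp only [rootCell, Bool.false_eq_true, ↓reduceIte]; omega)
  have hX := Xc_pos hδ (δ := δ)
  have hw' : fj 0 0 ∈ Lam δ false :=
    fj_row_zero_mem hδ hδ' false (i := 0) le_rfl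
      (by simp only [rootCell, Bool.false_eq_true, ↓reduceIte]; omega)
  exact nonempty_midEdgeSAW_of_preconnected (preconnected_Lam hδ hδ' false) (adj_hang _)
    (outer_not_mem hδ hδ' _) hw (fj_one_neg_one_not_mem hδ hδ' false) hw' (hang_ne_bEdge hk)

/-- **The rescaled root mid-edge converges to the marked point `1/5`.** [folklore] -/
theorem tendsto_smul_midpoint_hang :
    Tendsto (fun δ : ℝ => (δ : ℂ) * hexMidpoint (hang (kOf δ))) (𝓝[>] 0) (𝓝 (((1 / 5 : ℝ)) : ℂ)) := by
  have e : (fun δ : ℝ => (δ : ℂ) * hexMidpoint (hang (kOf δ))) =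
      fun δ : ℝ => (((δ * ((kOf δ : ℝ) + 1 / 2)) : ℝ) : ℂ) := by
    funext δ; rw [hexMidpoint_hang]; push_cast; ring
  rw [e]
  refine (Complex.continuous_ofReal.tendsto _).comp ?_
  rw [Metric.tendsto_nhds]
  intro ε hε
  filter_upwards [eventually_small (by positivity : 0 < ε / 2)] with δ hδ
  obtain ⟨hδ, hδ', hδε⟩ := hδ
  obtain ⟨-, h1, h2⟩ := kOf_spec hδ hδ'
  rw [Real.dist_eq, abs_lt]
  constructor <;> nlinarith

/-- **The gate sum contains the root term**: with the root inside the gate ball, the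
`Z(b_δ)`-free sum `Σ_{e ∈ ∂Λ_δ ∩ gate} Z_δ(e)` is at least `Z_δ(a_δ) = 1`. [folklore] -/
theorem one_le_gateSum {δ : ℝ} (hδ : 0 < δ) (hδ' : δ ≤ 1 / 16) :
    (1 : ℝ) ≤ ∑ᶠ e ∈ {e : Sym2 HexVertex | e ∈ hexDomainBoundary (Lam δ false) ∧
        (δ : ℂ) * hexMidpoint e ∈ Metric.ball (0 : ℂ) (1 / 4)},
      ‖hexParafermionicObservable (Lam δ false) (hang (kOf δ)) hexCriticalFugacity 0 e‖ := by
  have hfin : {e : Sym2 HexVertex | e ∈ hexDomainBoundary (Lam δ false) ∧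
      (δ : ℂ) * hexMidpoint e ∈ Metric.ball (0 : ℂ) (1 / 4)}.Finite :=
    (finite_hexDomainMidEdges (Lam δ false)).subset fun e he => hexDomainBoundary_subset _ he.1
  have hmem : hang (kOf δ) ∈ hfin.toFinset := by
    rw [Set.Finite.mem_toFinset]
    exact ⟨hang_mem_boundary hδ hδ', smul_midpoint_hang_mem_ball hδ hδ'⟩
  rw [finsum_mem_eq_finite_toFinset_sum _ hfin]
  refine le_trans (le_of_eq ?_) (Finset.single_le_sum (fun e _ => norm_nonneg _) hmem)
  rw [hexParafermionicObservable_self (hang_mem_boundary hδ hδ'), norm_one]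

/-! ### The refutation -/

/-- **`FlatGateBudget` (Ideator1Sketch, verbatim) is false.**  With the root inside the gate ball the
gate sum contains `Z_δ(a_δ) = 1`, so the budget gives `δ ≤ C · Z_δ(a_δ → b_δ)` eventually; along
`δ_k = 1/(5k)` the masses `Z_{δ_k}` are arrival masses of one strip at pairwise distinct α-edges,
summing to at most `1/cos(3π/8)` (DCS Lemma 2), whereas `Σ_k δ_k = ∞`.  Repair: keep the root out of
the gate (`ρ' < dist(pt 0, pt 1)` for the gate radius, or disjoint pin balls). [folklore] -/
theorem not_flatGateBudget : ¬ (∀ (D : DobrushinDomain) (ρ : ℝ) (Λ : ℝ → Finset HexVertex)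
    (m : Fin 2 → ℝ → ℤ) (a b : ℝ → Sym2 HexVertex),
    let Z : ℝ → Sym2 HexVertex → ℂ := fun δ z =>
      hexParafermionicObservable (Λ δ) (a δ) hexCriticalFugacity 0 z
    0 < ρ →
    (∀ i : Fin 2, D.carrier ∩ Metric.ball (D.pt i) ρ =
        {z : ℂ | (D.pt i).im < z.im} ∩ Metric.ball (D.pt i) ρ) →
    (∀ᶠ δ : ℝ in nhdsWithin 0 (Set.Ioi 0),
        hexDomainSimplyConnected (Λ δ) ∧ a δ ∈ hexDomainBoundary (Λ δ) ∧
          b δ ∈ hexDomainBoundary (Λ δ) ∧ Nonempty (HexMidEdgeSAW (Λ δ) (a δ) (b δ)) ∧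
          (hexGraph.induce ((Λ δ : Finset HexVertex) : Set HexVertex)).Preconnected ∧
          (∀ v ∈ Λ δ, (δ : ℂ) * hexCenter v ∈ D.carrier) ∧
          (∀ i : Fin 2, ∀ v : HexVertex, (δ : ℂ) * hexCenter v ∈ Metric.ball (D.pt i) ρ →
            (v ∈ Λ δ ↔ m i δ ≤ v.1 1))) →
    (∀ K : Set ℂ, IsCompact K → K ⊆ D.carrier → ∀ᶠ δ : ℝ in nhdsWithin 0 (Set.Ioi 0),
        ∀ v : HexVertex, (δ : ℂ) * hexCenter v ∈ K → v ∈ Λ δ) →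
    Tendsto (fun δ : ℝ => (δ : ℂ) * hexMidpoint (a δ)) (nhdsWithin 0 (Set.Ioi 0)) (nhds (D.pt 0)) →
    Tendsto (fun δ : ℝ => (δ : ℂ) * hexMidpoint (b δ)) (nhdsWithin 0 (Set.Ioi 0)) (nhds (D.pt 1)) →
    ∃ C : ℝ, ∀ᶠ δ : ℝ in nhdsWithin 0 (Set.Ioi 0),
      δ * (∑ᶠ e ∈ {e : Sym2 HexVertex | e ∈ hexDomainBoundary (Λ δ) ∧
            (δ : ℂ) * hexMidpoint e ∈ Metric.ball (D.pt 1) ρ}, ‖Z δ e‖) ≤ C * ‖Z δ (b δ)‖) := by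
  intro H
  have hr : (0 : ℝ) < 1 / 5 ∧ (1 / 5 : ℝ) < 1 := by norm_num
  have hA : 0 < Real.cos (3 * Real.pi / 8) := cos_three_pi_div_eight_pos
  have H' := H (halfDiscDomain (1 / 5) hr) (1 / 4) (fun δ => Lam δ false) (fun _ _ => 0)
    (fun δ => hang (kOf δ)) (fun _ => bEdge)
  simp only [pt_zero_halfDiscDomain, pt_one_halfDiscDomain] at H'
  -- the frame hypotheses
  have hflat : ∀ i : Fin 2, (halfDiscDomain (1 / 5) hr).carrier ∩
      Metric.ball ((halfDiscDomain (1 / 5) hr).pt i) (1 / 4) =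
      {z : ℂ | ((halfDiscDomain (1 / 5) hr).pt i).im < z.im} ∩
        Metric.ball ((halfDiscDomain (1 / 5) hr).pt i) (1 / 4) := by
    refine Fin.forall_fin_two.2 ⟨?_, ?_⟩
    · rw [pt_zero_halfDiscDomain]
      show HD ∩ _ = _
      exact HD_inter_ball_real (p := 1 / 5) (ρ := 1 / 4) (by rw [abs_of_pos hr.1]; norm_num)
    · rw [pt_one_halfDiscDomain]
      show HD ∩ _ = _
      simpa using HD_inter_ball_real (p := 0) (ρ := 1 / 4) (by norm_num)
  have hframe : ∀ᶠ δ : ℝ in 𝓝[>] 0, hexDomainSimplyConnected (Lam δ false) ∧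
      hang (kOf δ) ∈ hexDomainBoundary (Lam δ false) ∧ bEdge ∈ hexDomainBoundary (Lam δ false) ∧
      Nonempty (HexMidEdgeSAW (Lam δ false) (hang (kOf δ)) bEdge) ∧
      (hexGraph.induce ((Lam δ false : Finset HexVertex) : Set HexVertex)).Preconnected ∧
      (∀ v ∈ Lam δ false, (δ : ℂ) * hexCenter v ∈ (halfDiscDomain (1 / 5) hr).carrier) ∧
      (∀ i : Fin 2, ∀ v : HexVertex, (δ : ℂ) * hexCenter v ∈
        Metric.ball ((halfDiscDomain (1 / 5) hr).pt i) (1 / 4) → (v ∈ Lam δ false ↔ (0 : ℤ) ≤ v.1 1)) := by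
    filter_upwards [eventually_small one_pos] with δ hδ
    obtain ⟨hδ, hδ', -⟩ := hδ
    refine ⟨simplyConnected_Lam hδ hδ' false, hang_mem_boundary hδ hδ', bEdge_mem_boundary hδ hδ' false,
      nonempty_saw_hang hδ hδ', preconnected_Lam hδ hδ' false,
      fun v hv => smul_center_mem_HD hδ hδ' false hv, ?_⟩
    refine Fin.forall_fin_two.2 ⟨fun v hv => ?_, fun v hv => ?_⟩
    · rw [pt_zero_halfDiscDomain, Metric.mem_ball] at hv
      refine mem_Lam_iff_of_ball hδ hδ' false ?_
      rw [Metric.mem_ball]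
      have h2 : dist (((1 / 5 : ℝ) : ℂ)) 0 = 1 / 5 := by
        rw [dist_zero_right, Complex.norm_real, Real.norm_of_nonneg (by norm_num)]
      calc dist ((δ : ℂ) * hexCenter v) 0
          ≤ dist ((δ : ℂ) * hexCenter v) ((1 / 5 : ℝ) : ℂ) + dist (((1 / 5 : ℝ) : ℂ)) 0 :=
            dist_triangle _ _ _
        _ < 1 / 4 + 1 / 5 := by rw [h2]; linarith
        _ ≤ 1 / 2 := by norm_num
    · rw [pt_one_halfDiscDomain, Metric.mem_ball] at hv
      refine mem_Lam_iff_of_ball hδ hδ' false ?_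
      rw [Metric.mem_ball]
      linarith
  have hexh : ∀ K : Set ℂ, IsCompact K → K ⊆ (halfDiscDomain (1 / 5) hr).carrier →
      ∀ᶠ δ : ℝ in 𝓝[>] 0, ∀ v : HexVertex, (δ : ℂ) * hexCenter v ∈ K → v ∈ Lam δ false := by
    intro K hK hKD
    obtain ⟨ε, hε, -, hthick⟩ := exists_thick_of_isCompact hK hKD
    filter_upwards [eventually_small (by positivity : 0 < ε / 4)] with δ hδ v hv
    obtain ⟨hδ, hδ', hδε⟩ := hδ
    obtain ⟨hn, hi⟩ := hthick _ hv
    exact mem_Lam_of_thick hδ hδ' false hδε hn hi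
  obtain ⟨C, hC⟩ := H' (by norm_num) hflat hframe hexh tendsto_smul_midpoint_hang
    tendsto_smul_midpoint_bEdge
  -- Step 1: the gate sum contains the root term `Z(a_δ) = 1`, so `δ ≤ C · Z_δ(b_δ)` eventually
  have h1 : ∀ᶠ δ : ℝ in 𝓝[>] 0, 0 < δ ∧ δ ≤ 1 / 16 ∧
      δ ≤ C * ‖hexParafermionicObservable (Lam δ false) (hang (kOf δ)) hexCriticalFugacity 0 bEdge‖ := by
    filter_upwards [hC, eventually_small one_pos] with δ hδC hδ
    obtain ⟨hδ, hδ', -⟩ := hδ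
    exact ⟨hδ, hδ', le_trans (le_mul_of_one_le_right hδ.le (one_le_gateSum hδ hδ')) hδC⟩
  obtain ⟨δ₀, hδ₀, hsub⟩ := mem_nhdsGT_iff_exists_Ioo_subset.1 h1
  rw [Set.mem_Ioi] at hδ₀
  -- Step 2: `C > 0`
  have hC0 : 0 < C := by
    obtain ⟨h0, -, hle⟩ := hsub ⟨half_pos hδ₀, half_lt_self hδ₀⟩
    by_contra hC
    push Not at hC
    nlinarith [norm_nonneg (hexParafermionicObservable (Lam (δ₀ / 2) false) (hang (kOf (δ₀ / 2)))
      hexCriticalFugacity 0 bEdge)]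
  -- Step 3: along `δ_k = 1/(5k)`, `k ≥ k₀`
  obtain ⟨n, hn⟩ := exists_nat_gt (1 / (5 * δ₀))
  set k₀ : ℕ := max n 4 with hk₀
  have hk₀4 : 4 ≤ k₀ := le_max_right _ _
  have hk₀n : n ≤ k₀ := le_max_left _ _
  have hkey : ∀ k : ℕ, k₀ ≤ k → (1 : ℝ) / (5 * k) ≤
      C * ‖hexParafermionicObservable (Lam (1 / (5 * k)) false) (hang k) hexCriticalFugacity 0 bEdge‖ ∧
      (0 : ℝ) < 1 / (5 * k) ∧ (1 : ℝ) / (5 * k) ≤ 1 / 16 := by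
    intro k hkk
    have hkpos : (0 : ℝ) < k := by exact_mod_cast (show 0 < k by omega)
    have hk1 : (1 : ℝ) / (5 * k) < δ₀ := by
      rw [div_lt_iff₀ (by positivity)]
      have h' := hn
      rw [div_lt_iff₀ (by positivity)] at h'
      have : (n : ℝ) ≤ k := by exact_mod_cast hk₀n.trans hkk
      nlinarith
    obtain ⟨h0, h16, hle⟩ := hsub ⟨by positivity, hk1⟩
    rw [kOf_at (show k ≠ 0 by omega)] at hle
    exact ⟨hle, h0, h16⟩
  -- Step 4: the masses `Z_{δ_k}`, `k₀ ≤ k < N`, are arrival masses of ONE strip: total ≤ 1/cos(3π/8)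
  have hsum : ∀ N : ℕ, ∑ k ∈ Finset.Ico k₀ N,
      ‖hexParafermionicObservable (Lam (1 / (5 * k)) false) (hang k) hexCriticalFugacity 0 bEdge‖ ≤
      (Real.cos (3 * Real.pi / 8))⁻¹ := by
    intro N
    refine sum_norm_obs_le_stripA (K := Finset.Ico k₀ N) (fun k hk => ?_)
      (fun k => Lam (1 / (5 * k)) false) (fun k hk => ?_) (fun k hk => ?_)
      (T := 20 * N + 2) (L := 21 * N + 2) (by omega) (fun k hk => ?_)
    · have := (Finset.mem_Ico.1 hk).1; omega
    · obtain ⟨-, h0, h16⟩ := hkey k (Finset.mem_Ico.1 hk).1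
      exact fj_one_neg_one_not_mem h0 h16 false
    · obtain ⟨-, h0, h16⟩ := hkey k (Finset.mem_Ico.1 hk).1
      exact outer_not_mem h0 h16 k
    · obtain ⟨-, h0, h16⟩ := hkey k (Finset.mem_Ico.1 hk).1
      have hkN' : k < N := (Finset.mem_Ico.1 hk).2
      have hkN : (k : ℝ) ≤ N := by exact_mod_cast hkN'.le
      refine map_chartK_subset_stripV h0 h16 k (B := 20 * N) ?_ (by push_cast; omega)
        (by push_cast; omega)
      rw [one_div, inv_inv]
      push_cast
      nlinarith
  -- Step 5: bounded partial sums of `Σ 1/(5k)` — impossible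
  set A : ℝ := (Real.cos (3 * Real.pi / 8))⁻¹ with hAdef
  have hA0 : 0 ≤ A := inv_nonneg.2 hA.le
  set f : ℕ → ℝ := fun k => 1 / (5 * (k : ℝ)) with hf
  have hf0 : ∀ k, 0 ≤ f k := fun k => by positivity
  have hIco : ∀ N, ∑ k ∈ Finset.Ico k₀ N, f k ≤ C * A := by
    intro N
    calc ∑ k ∈ Finset.Ico k₀ N, f k
        ≤ ∑ k ∈ Finset.Ico k₀ N, C * ‖hexParafermionicObservable (Lam (1 / (5 * k)) false) (hang k)
            hexCriticalFugacity 0 bEdge‖ :=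
          Finset.sum_le_sum fun k hk => (hkey k (Finset.mem_Ico.1 hk).1).1
      _ = C * ∑ k ∈ Finset.Ico k₀ N, ‖hexParafermionicObservable (Lam (1 / (5 * k)) false) (hang k)
            hexCriticalFugacity 0 bEdge‖ := by rw [← Finset.mul_sum]
      _ ≤ C * A := by gcongr; exact hsum N
  have hbound : ∀ N, ∑ k ∈ Finset.range N, f k ≤ ∑ k ∈ Finset.range k₀, f k + C * A := by
    intro N
    have hCA : 0 ≤ C * A := mul_nonneg hC0.le hA0
    rcases le_or_gt k₀ N with hN | hN
    · rw [← Finset.sum_range_add_sum_Ico f hN]; linarith [hIco N]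
    · calc ∑ k ∈ Finset.range N, f k ≤ ∑ k ∈ Finset.range k₀, f k :=
            Finset.sum_le_sum_of_subset_of_nonneg (Finset.range_mono hN.le) fun k _ _ => hf0 k
        _ ≤ _ := by linarith
  have hsumm : Summable f := summable_of_sum_range_le hf0 hbound
  have h1k : Summable fun k : ℕ => (1 : ℝ) / k := by
    refine (hsumm.mul_left 5).congr fun k => ?_
    show 5 * (1 / (5 * (k : ℝ))) = 1 / k
    rcases Nat.eq_zero_or_pos k with rfl | hk
    · simp
    · field_simp
  exact Real.not_summable_one_div_natCast h1k

end Summit.CriticalPhenomena.SAWScalingLimit.Theorems.BoundaryClosureR.Negative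

end
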